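import Summits.AtomisticToContinuum.FouriersLaw.Theorems.JunctionLocalityNonBallisticProfileUniformBound

/-!
# `NonBallistic` / line `contact-current-forgetting`: the contraction profile is twice the left profile

Helper file (`--supports stmt-AtomisticToContinuum-9127`) for the line's central object, the contraction profile
`φ_N(s) = ‖κ_s j_0‖²_{L²(μ_T)} + ‖κ_s j_{N-2}‖²_{L²(μ_T)}` (`contactProfile`, `Theorems/JunctionLocalityDefs.lean`).

* `bondCurrentAt_far_siteReflection` — `j_{N-2}(R z) = -j_0(z)` for the site reflection `R` (even interaction);
* `pinnedChain_evolve_far_siteReflection` — `(κ_s j_{N-2})(R z) = -(κ_s j_0)(z)` (reflection covariance of the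
  equal-temperature kernels, `OddSectorWitness.transitionKernel_siteReflection`);
* `pinnedChain_contactProfile_eq_two_mul` — **`φ_N(s) = 2‖κ_s j_0‖²_{L²(μ_T)}`** for `N ≥ 2` and every real `s`
  (`R_* μ_T = μ_T`, `measurePreserving_siteReflection_gibbsMeasure`).

So the registered stub `stub_recurrentContactForgetting` (recurrently small tails of `φ_N`) is a statement about ONE
semigroup orbit, the left contact current `κ_s j_0`; the symmetric form of `contactProfile` was chosen only so that the
composition never needs the reflection.
-/

noncomputable section

namespace Summit.AtomisticToContinuum.FouriersLaw.Theorems.NonBallistic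

open MeasureTheory ProbabilityTheory Set Filter Topology
open scoped NNReal ENNReal
open Literature.MathematicalPhysics.KineticTheory.HeatConduction
open Summit.AtomisticToContinuum.FouriersLaw.Theorems.JunctionLocality

/-- **The far contact current is the reflected near one**: for a chain with even interaction and `N ≥ 2`,
`j_{N-2}(R z) = -j_0(z)` (`bondCurrentAt` form of `bondCurrent_siteReflection`). [folklore] -/
theorem bondCurrentAt_far_siteReflection (P : OscillatorChain) (hV : ∀ r, P.V (-r) = P.V r) {N : ℕ}
    (hN : 2 ≤ N) (z : PhaseSpace N) :
    bondCurrentAt P N (N - 2) (siteReflection N z) = -bondCurrentAt P N 0 z := by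
  rw [bondCurrentAt_eq_bondCurrent P (show N - 2 < N by omega),
    bondCurrentAt_eq_bondCurrent P (show 0 < N by omega)]
  have hrev : Fin.rev (⟨N - 1, by omega⟩ : Fin N) = ⟨0, by omega⟩ := by
    ext; simp only [Fin.val_rev]; omega
  rw [P.bondCurrent_siteReflection hV N ⟨N - 2, by omega⟩ ⟨N - 1, by omega⟩ (by simp; omega) z, hrev]

/-- **Reflection covariance of the evolved far contact current**: for the pinned chain (`ω₂ > 0`, `lam, β, γ ≥ 0`),
`N ≥ 2`, every `T` and every real `s`, `(κ_s j_{N-2})(R z) = -(κ_s j_0)(z)` — the kernels are reflection covariant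
at equal bath temperatures (`transitionKernel_siteReflection`) and `j_{N-2} ∘ R = -j_0`. [folklore] -/
theorem pinnedChain_evolve_far_siteReflection {ω₂ lam β γ : ℝ} (hω : 0 < ω₂) (hl : 0 ≤ lam) (hβ : 0 ≤ β)
    (hγ : 0 ≤ γ) {N : ℕ} (hN : 2 ≤ N) (T s : ℝ) (z : PhaseSpace N) :
    evolve (pinnedChain ω₂ lam β γ) N T (bondCurrentAt (pinnedChain ω₂ lam β γ) N (N - 2)) s (siteReflection N z) =
      -evolve (pinnedChain ω₂ lam β γ) N T (bondCurrentAt (pinnedChain ω₂ lam β γ) N 0) s z := by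
  set P := pinnedChain ω₂ lam β γ with hP
  unfold evolve
  rw [OddSectorWitness.transitionKernel_siteReflection hω hl hβ hγ N T s.toNNReal z]
  have hc : Continuous (bondCurrentAt P N (N - 2)) := MidpointContraction.continuous_bondCurrentAt ω₂ lam β γ N (N - 2)
  rw [integral_map measurable_siteReflection.aemeasurable hc.aestronglyMeasurable, ← integral_neg]
  refine integral_congr_ae (Eventually.of_forall fun y => ?_)
  exact bondCurrentAt_far_siteReflection P (pinnedChain_V_neg ω₂ lam β γ) hN y

/-- **The contraction profile is twice the left profile**: for the pinned chain (all parameters positive), `T > 0`,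
`N ≥ 2` and every real `s`, `φ_N(s) = 2 ∫ (κ_s j_0)² dμ_T = 2‖κ_s j_0‖²_{L²(μ_T)}` (site reflection preserves
`μ_T` and carries `κ_s j_{N-2}` to `-κ_s j_0`). [folklore] -/
theorem pinnedChain_contactProfile_eq_two_mul :
    ∀ ω₂ lam β γ : ℝ, 0 < ω₂ → 0 < lam → 0 < β → 0 < γ → ∀ T : ℝ, 0 < T → ∀ N : ℕ, 2 ≤ N → ∀ s : ℝ,
      contactProfile (pinnedChain ω₂ lam β γ) N T s =
        2 * ∫ z, (evolve (pinnedChain ω₂ lam β γ) N T (bondCurrentAt (pinnedChain ω₂ lam β γ) N 0) s z) ^ 2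
          ∂((pinnedChain ω₂ lam β γ).gibbsMeasure N T) := by
  intro ω₂ lam β γ hω hl hβ hγ T hT N hN s
  set P := pinnedChain ω₂ lam β γ with hP
  have hN0 : 0 < N := by omega
  obtain ⟨-, h0, -, -, -⟩ := MidpointContraction.evolve_facts hω hl.le hβ hγ hN0 hT 0 s.toNNReal
  obtain ⟨-, hN2, -, -, -⟩ := MidpointContraction.evolve_facts hω hl.le hβ hγ hN0 hT (N - 2) s.toNNReal
  have hR := measurePreserving_siteReflection_gibbsMeasure P (pinnedChain_V_neg ω₂ lam β γ) N T
  -- ∫ (κ_s j_{N-2})² dμ_T = ∫ ((κ_s j_{N-2}) ∘ R)² dμ_T = ∫ (κ_s j_0)² dμ_T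
  have hfar : ∫ z, (evolve P N T (bondCurrentAt P N (N - 2)) s z) ^ 2 ∂(P.gibbsMeasure N T) =
      ∫ z, (evolve P N T (bondCurrentAt P N 0) s z) ^ 2 ∂(P.gibbsMeasure N T) := by
    have h := hR.integral_comp (siteReflectionEquiv N).measurableEmbedding
      (fun z => (evolve P N T (bondCurrentAt P N (N - 2)) s z) ^ 2)
    rw [← h]
    refine integral_congr_ae (Eventually.of_forall fun z => ?_)
    show (evolve P N T (bondCurrentAt P N (N - 2)) s (siteReflection N z)) ^ 2 = _
    rw [pinnedChain_evolve_far_siteReflection hω hl.le hβ.le hγ.le hN T s z, neg_sq]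
  have h0' : Integrable (fun z => (evolve P N T (bondCurrentAt P N 0) s z) ^ 2) (P.gibbsMeasure N T) := h0
  have hN2' : Integrable (fun z => (evolve P N T (bondCurrentAt P N (N - 2)) s z) ^ 2) (P.gibbsMeasure N T) := hN2
  unfold contactProfile
  rw [integral_add h0' hN2', hfar, two_mul]

end Summit.AtomisticToContinuum.FouriersLaw.Theorems.NonBallistic

end
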